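/-
Copyright: the b2b-balaban cell (near-miss cell 7), T⁴-continuum CRUX team (coordinator ruling e34b3e0c item (2)),
lineage t4-ne7b-formalise-leaf-04 (gen 26). Released under the licence of the surrounding project.
-/
import Summits.QuantumFields.BalabanUV.T4Continuum.Spine.NE7b.HealingMapSteps

/-!
# H2 in product form with the domination asked ONLY ON THE FUNCTIONS REACHED by the bad branch (route R-H of
# `t4/ROUTES-NE7b.md`; the crux refuter's PRICING-NE7b v5 F24 and leaf-06's XREAD INFO 1 on `…NE7b.HealingMapSteps`:
# «`hdom` is CONTEXT-FREE … weaken to the support reached downstream ∕ a narrowed good class»)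

Cell `pub-balaban`, sub-cell `t4`, spine estimate NE7b (node U5c), candidate route R-H «Peierls healing map».  The
lineage's `…B16HistoryIndexedRepr.RelLinPosOp.piR_le_prod_mul_piR` (p251315, `Spine/NE7b/HealingMapSteps.lean`)
composes STEP-WISE domination multiplicatively along the composite `piR` of a list of relative positive operations —
but asks the domination `(P d).T F x ≤ f d · (Q d).T F x` for EVERY non-negative good function `F` on the one space
`C`, per step label `d` (hypothesis `hdom`).  Two readers LOCATED the same interface condition (no gap in the kernel;
a constraint on how the route's step alphabet must be presented):
* crux refuter, PRICING-NE7b v5 **F24**: R-H's H3 readings dominate the bad branch's operation by the healed one ONLY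
  in the presence of the common exterior small-field functions — so `hdom` is inhabitable iff every step operation
  is DRESSED with those characteristic functions, «or else `hdom` must be weakened to ‹∀ x in the support reached
  downstream› (≈ 20 lines: thread a support predicate through `piR_good`)»;
* leaf-06 g27, XREAD X4 **INFO 1** (CLAIMS l.28224): «`hdom d` quantifies over ALL good non-negative seeds …
  inhabitable for Bałaban's branches only with GROUPED step labels or a NARROWED good class».

THIS FILE supplies both weakenings next to the landed lemma (which is untouched; [folklore]; zero `sorry`; nothing
of Bałaban's asserted; imports `HealingMapSteps` only):
* §1 **`RelLinPosOp.piR_le_prod_mul_piR_of_invariant`** — A NARROWED CLASS WITHOUT TOUCHING `GoodClass`: any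
  predicate `Pred` on functions that holds for the seed and is PRESERVED by the bad branch's steps («carries the
  common small-field factor», «no longer depends on the healed cubes' variables», «supported in the look-in», …)
  restricts the seeds on which `hdom d` is asked; the conclusion is unchanged
  (`(piR P l).T F ≤ (l.map f).prod · (piR Q l).T F` pointwise).  `piR_pred` threads the predicate through the
  composite (the refuter's «support predicate through `piR_good`»).
* §2 **`RelLinPosOp.piR_le_prod_mul_piR_of_reached`** — THE SHARP FORM: along a GIVEN list `l`, domination is
  asked at step `d` only on the ONE function the bad branch actually presents there, the inner composite
  `(piR P l′).T F` for the suffix `d :: l′` of `l` — nothing else is ever used by the induction.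
* §3 the integrated twins **`integral_piR_le_prod_mul_of_invariant`** ∕ **`integral_piR_le_prod_mul_of_reached`**
  (the `le_heal` of `NE7b.HealingMap.HealingLaws` in product form under the weakened domination), and a consistency
  `example`: the landed context-free lemma is the case `Pred := ⊤` of §1.

NOT HERE (honest): WHICH predicate Bałaban's dressed step alphabet preserves and that the H3 readings inhabit the
narrowed `hdom` (H3 ∕ (MP<L²), OPEN, refuter-priced) — displayed hypotheses.  BY-NAME EFFECT ON THE WALL
(`WALL-NE7b-P1.md` §2): NONE.  NE7b NOT PRINTED, NOT PROVED; spine PROVED 0∕9; rung (B)+1 on a FINITE torus T⁴ — NOT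
infinite volume, NOT the mass gap, NOT Clay.  POLICY (ruling e34b3e0c): crux-route work of item (2) booked to leaf-04
by the crux refuter (PRICING-NE7b v5 §R-H «outstanding cheap items: … F24 `hdom` dressing»); NOT a
`T4Continuum/Support` leaf; no definition, no fact minted.
HONEST DEPENDENCY: continuum YM on T⁴ ⇐ BetaPertH ∧ nine spine estimates (0/9 proved); BetaPertH ⇐ (D1) ∧ (D4) ∧
CAP+tail; G-an2-4 gates asym, D1 and NE2/3/4.  This file changes none of it.
-/

set_option autoImplicit false

open MeasureTheory

namespace Summit.QuantumFields.BalabanUV.T4Continuum.B16HistoryIndexedRepr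

namespace RelLinPosOp

variable {C : Type*} {𝒢 : GoodClass C} {δ : Type*}

/-! ## §1 Domination on a NARROWED class of seeds: an invariant predicate threaded through the composite -/

/-- An invariant of the bad branch's steps holds along its whole composite: if `Pred` holds for the non-negative good
seed `F` and is preserved by every `P d` on non-negative good functions, then `Pred ((piR P l).T F)` for every list
`l`. [folklore] -/
theorem piR_pred (P : δ → RelLinPosOp 𝒢) (Pred : (C → ℝ) → Prop)
    (hPred : ∀ d (G : C → ℝ), 𝒢.Gd G → (∀ y, 0 ≤ G y) → Pred G → Pred ((P d).T G))
    {F : C → ℝ} (hF : 𝒢.Gd F) (hF0 : ∀ y, 0 ≤ F y) (hPF : Pred F) :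
    ∀ l : List δ, Pred ((piR P l).T F)
  | [] => hPF
  | d :: l => hPred d _ (piR_good P hF l) (piR_nonneg P hF hF0 l) (piR_pred P Pred hPred hF hF0 hPF l)

/-- **STEP-WISE DOMINATION ON A NARROWED CLASS COMPOSES MULTIPLICATIVELY** (F24 ∕ leaf-06 X4 INFO 1: `hdom` asked
only on the seeds satisfying an invariant `Pred` of the bad branch — e.g. «carries the common exterior small-field
characteristic functions», «is constant in the healed cubes' step-`d` variables»).  If `Pred` holds for the seed and
is preserved by the bad branch's steps, and for every step label `d` the operation `P d` is dominated by `f d ×` the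
operation `Q d` on the non-negative good functions SATISFYING `Pred`, with `f d ≥ 0`, then
`(piR P l).T F ≤ (l.map f).prod · (piR Q l).T F` pointwise, for every list `l`. [folklore] -/
theorem piR_le_prod_mul_piR_of_invariant (P Q : δ → RelLinPosOp 𝒢) (f : δ → ℝ) (hf : ∀ d, 0 ≤ f d)
    (Pred : (C → ℝ) → Prop)
    (hPred : ∀ d (G : C → ℝ), 𝒢.Gd G → (∀ y, 0 ≤ G y) → Pred G → Pred ((P d).T G))
    (hdom : ∀ d (G : C → ℝ), 𝒢.Gd G → (∀ y, 0 ≤ G y) → Pred G → ∀ x, (P d).T G x ≤ f d * (Q d).T G x)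
    {F : C → ℝ} (hF : 𝒢.Gd F) (hF0 : ∀ y, 0 ≤ F y) (hPF : Pred F) :
    ∀ (l : List δ) (x : C), (piR P l).T F x ≤ (l.map f).prod * (piR Q l).T F x
  | [], x => by
      show F x ≤ (([] : List δ).map f).prod * F x
      simp
  | d :: l, x => by
      have hA : 𝒢.Gd ((piR P l).T F) := piR_good P hF l
      have hB : 𝒢.Gd ((piR Q l).T F) := piR_good Q hF l
      have hA0 : ∀ y, 0 ≤ (piR P l).T F y := piR_nonneg P hF hF0 l
      have hAP : Pred ((piR P l).T F) := piR_pred P Pred hPred hF hF0 hPF l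
      have hAB : ∀ y, (piR P l).T F y ≤ (l.map f).prod * (piR Q l).T F y :=
        piR_le_prod_mul_piR_of_invariant P Q f hf Pred hPred hdom hF hF0 hPF l
      show (P d).T ((piR P l).T F) x ≤ ((d :: l).map f).prod * (Q d).T ((piR Q l).T F) x
      rw [List.map_cons, List.prod_cons]
      calc (P d).T ((piR P l).T F) x ≤ f d * (Q d).T ((piR P l).T F) x := hdom d _ hA hA0 hAP x
        _ ≤ f d * ((l.map f).prod * (Q d).T ((piR Q l).T F) x) :=
            mul_le_mul_of_nonneg_left ((Q d).apply_le_mul_apply_of_le hA hB hAB x) (hf d)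
        _ = f d * (l.map f).prod * (Q d).T ((piR Q l).T F) x := by ring

/-- Consistency: the landed CONTEXT-FREE lemma `piR_le_prod_mul_piR` (p251315) is the case `Pred := ⊤` — nothing is
lost by narrowing. -/
example (P Q : δ → RelLinPosOp 𝒢) (f : δ → ℝ) (hf : ∀ d, 0 ≤ f d)
    (hdom : ∀ d (F : C → ℝ), 𝒢.Gd F → (∀ y, 0 ≤ F y) → ∀ x, (P d).T F x ≤ f d * (Q d).T F x)
    {F : C → ℝ} (hF : 𝒢.Gd F) (hF0 : ∀ y, 0 ≤ F y) (l : List δ) (x : C) :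
    (piR P l).T F x ≤ (l.map f).prod * (piR Q l).T F x :=
  piR_le_prod_mul_piR_of_invariant P Q f hf (fun _ => True) (fun _ _ _ _ _ => trivial)
    (fun d G hG hG0 _ => hdom d G hG hG0) hF hF0 trivial l x

/-! ## §2 Domination on exactly the functions REACHED by the bad branch along a given list -/

/-- **THE SHARP FORM: DOMINATION ON THE FUNCTIONS ACTUALLY REACHED.**  Along a given list of steps `l`, the bad
branch presents to the step `d` exactly ONE function — the inner composite `(piR P l′).T F` for the suffix
`d :: l′` of `l` (whatever characteristic functions the inner steps have put there ARE there).  If `P d` is dominated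
by `f d ×` `Q d` on THAT function, for every such suffix, with `f d ≥ 0`, then
`(piR P l).T F ≤ (l.map f).prod · (piR Q l).T F` pointwise. [folklore] -/
theorem piR_le_prod_mul_piR_of_reached (P Q : δ → RelLinPosOp 𝒢) (f : δ → ℝ) (hf : ∀ d, 0 ≤ f d)
    {F : C → ℝ} (hF : 𝒢.Gd F) (hF0 : ∀ y, 0 ≤ F y) :
    ∀ l : List δ,
      (∀ (d : δ) (l' : List δ), d :: l' <:+ l →
        ∀ x, (P d).T ((piR P l').T F) x ≤ f d * (Q d).T ((piR P l').T F) x) →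
      ∀ x : C, (piR P l).T F x ≤ (l.map f).prod * (piR Q l).T F x
  | [], _, x => by
      show F x ≤ (([] : List δ).map f).prod * F x
      simp
  | d :: l, hdom, x => by
      have hA : 𝒢.Gd ((piR P l).T F) := piR_good P hF l
      have hB : 𝒢.Gd ((piR Q l).T F) := piR_good Q hF l
      -- the tail's hypothesis: every suffix of `l` is a suffix of `d :: l`
      have hAB : ∀ y, (piR P l).T F y ≤ (l.map f).prod * (piR Q l).T F y :=
        piR_le_prod_mul_piR_of_reached P Q f hf hF hF0 l fun d' l' h => hdom d' l' (h.trans (List.suffix_cons d l))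
      show (P d).T ((piR P l).T F) x ≤ ((d :: l).map f).prod * (Q d).T ((piR Q l).T F) x
      rw [List.map_cons, List.prod_cons]
      calc (P d).T ((piR P l).T F) x ≤ f d * (Q d).T ((piR P l).T F) x := hdom d l (List.suffix_refl _) x
        _ ≤ f d * ((l.map f).prod * (Q d).T ((piR Q l).T F) x) :=
            mul_le_mul_of_nonneg_left ((Q d).apply_le_mul_apply_of_le hA hB hAB x) (hf d)
        _ = f d * (l.map f).prod * (Q d).T ((piR Q l).T F) x := by ring

/-- The invariant form follows from the sharp form (every reached function satisfies the invariant) — recorded as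
the proof that §2 is indeed the weakest hypothesis of this induction. -/
example (P Q : δ → RelLinPosOp 𝒢) (f : δ → ℝ) (hf : ∀ d, 0 ≤ f d) (Pred : (C → ℝ) → Prop)
    (hPred : ∀ d (G : C → ℝ), 𝒢.Gd G → (∀ y, 0 ≤ G y) → Pred G → Pred ((P d).T G))
    (hdom : ∀ d (G : C → ℝ), 𝒢.Gd G → (∀ y, 0 ≤ G y) → Pred G → ∀ x, (P d).T G x ≤ f d * (Q d).T G x)
    {F : C → ℝ} (hF : 𝒢.Gd F) (hF0 : ∀ y, 0 ≤ F y) (hPF : Pred F) (l : List δ) (x : C) :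
    (piR P l).T F x ≤ (l.map f).prod * (piR Q l).T F x :=
  piR_le_prod_mul_piR_of_reached P Q f hf hF hF0 l
    (fun d l' _ => hdom d _ (piR_good P hF l') (piR_nonneg P hF hF0 l') (piR_pred P Pred hPred hF hF0 hPF l')) x

/-! ## §3 Integrated: the bad branch's weight under the weakened domination -/

/-- **H2 IN PRODUCT FORM ON A NARROWED CLASS, INTEGRATED**: under step-wise domination asked only on the seeds
satisfying an invariant `Pred` of the bad branch, the bad branch's weight is at most `(Π factor)` times the healed
branch's weight (`NE7b.HealingMap.integral_le_mul_integral_of_le` BY NAME). [folklore] -/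
theorem integral_piR_le_prod_mul_of_invariant [MeasurableSpace C] (μ : Measure C) (P Q : δ → RelLinPosOp 𝒢)
    (f : δ → ℝ) (hf : ∀ d, 0 ≤ f d) (Pred : (C → ℝ) → Prop)
    (hPred : ∀ d (G : C → ℝ), 𝒢.Gd G → (∀ y, 0 ≤ G y) → Pred G → Pred ((P d).T G))
    (hdom : ∀ d (G : C → ℝ), 𝒢.Gd G → (∀ y, 0 ≤ G y) → Pred G → ∀ x, (P d).T G x ≤ f d * (Q d).T G x)
    {F : C → ℝ} (hF : 𝒢.Gd F) (hF0 : ∀ y, 0 ≤ F y) (hPF : Pred F) (l : List δ)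
    (hint : Integrable ((piR Q l).T F) μ) :
    ∫ x, (piR P l).T F x ∂μ ≤ (l.map f).prod * ∫ x, (piR Q l).T F x ∂μ :=
  NE7b.HealingMap.integral_le_mul_integral_of_le
    (Filter.Eventually.of_forall fun x => piR_nonneg P hF hF0 l x) hint
    (Filter.Eventually.of_forall fun x =>
      piR_le_prod_mul_piR_of_invariant P Q f hf Pred hPred hdom hF hF0 hPF l x)

/-- **H2 IN PRODUCT FORM ON THE REACHED FUNCTIONS, INTEGRATED**: the same under the sharp form of §2. [folklore] -/
theorem integral_piR_le_prod_mul_of_reached [MeasurableSpace C] (μ : Measure C) (P Q : δ → RelLinPosOp 𝒢)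
    (f : δ → ℝ) (hf : ∀ d, 0 ≤ f d) {F : C → ℝ} (hF : 𝒢.Gd F) (hF0 : ∀ y, 0 ≤ F y) (l : List δ)
    (hdom : ∀ (d : δ) (l' : List δ), d :: l' <:+ l →
      ∀ x, (P d).T ((piR P l').T F) x ≤ f d * (Q d).T ((piR P l').T F) x)
    (hint : Integrable ((piR Q l).T F) μ) :
    ∫ x, (piR P l).T F x ∂μ ≤ (l.map f).prod * ∫ x, (piR Q l).T F x ∂μ :=
  NE7b.HealingMap.integral_le_mul_integral_of_le
    (Filter.Eventually.of_forall fun x => piR_nonneg P hF hF0 l x) hint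
    (Filter.Eventually.of_forall fun x => piR_le_prod_mul_piR_of_reached P Q f hf hF hF0 l hdom x)

end RelLinPosOp

end Summit.QuantumFields.BalabanUV.T4Continuum.B16HistoryIndexedRepr
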